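import Literature.Probability.LatticeModels.PSContourSetup
import HarnessLib

/-!
# Pirogov–Sinai theory, II: resummation over external contours

Topic `Literature/Probability/LatticeModels`. The combinatorial identity behind the contour
representations (7.29)–(7.34) and the "external unstable contours" resummation (7.86) of
Friedli–Velenik 2017, Ch. 7, for the abstract contours of `PSContourSetup`: for a property `P` of
contours, every compatible family `Δ` of contours in a volume `V` decomposes uniquely into

* its **maximal `P`-members** `Γ = maxP P Δ` (those `P`-members not inside another `P`-member) — an
  external (pairwise hull-disjoint) family,
* for each `γ ∈ Γ` and each interior component `A` of `γ`, the compatible family of the members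
  inside `A`,
* and the remaining members, a compatible family of non-`P` contours in `V ∖ ⋃_{γ ∈ Γ} hull γ`,

and conversely (`sum_compFam_eq_sum_extFamP`); for `P ≡ True` this is the passage between the
external-contour representation (7.32) and the polymer representation (7.34)
(`sum_compFam_eq_sum_extFam`). We also prove the injection behind Lemma 7.26 (probabilities of
external contours): external families of `V` containing `γ₀` ↪ `γ₀` × external families of the
interior components of `γ₀` × external families of `V` away from `γ₀` (`sum_extFam_mem_le`).

Everything is proved; no named facts.

## References

* S. Friedli, Y. Velenik, *Statistical Mechanics of Lattice Systems*, CUP 2017, §7.3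
  (eqs. (7.29)–(7.34), Lemma 7.26) and §7.4.3 (proof of (7.68): fixing the external unstable
  contours, eq. (7.86)). [FriedliVelenik2017]
-/

noncomputable section

open Finset

namespace Literature.Probability.LatticeModels

variable {d : ℕ}

/-! ### Gluing families chosen independently in disjoint slots -/

section Slots

variable {α ι : Type*} [DecidableEq α]

/-- The union of the families chosen in the slots. [folklore] -/
def slotUnion (s : Finset ι) (p : (i : ι) → i ∈ s → Finset α) : Finset α := s.attach.biUnion fun i => p i.1 i.2

/-- Membership in the slot union. [folklore] -/
theorem mem_slotUnion {s : Finset ι} {p : (i : ι) → i ∈ s → Finset α} {a : α} :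
    a ∈ slotUnion s p ↔ ∃ i, ∃ h : i ∈ s, a ∈ p i h := by
  simp only [slotUnion, mem_biUnion, mem_attach, true_and, Subtype.exists]

/-- **Independent choices in slots with disjoint universes**: the product over the slots of the sums
over the allowed families of `∏ f` is the sum, over the glued families, of `∏ f`, and gluing is
injective. [folklore] -/
theorem prod_sum_prod_eq_sum_image_slotUnion [DecidableEq ι] (s : Finset ι) (t : ι → Finset (Finset α))
    (u : ι → Finset α) (htu : ∀ i ∈ s, ∀ Δ ∈ t i, Δ ⊆ u i) (hu : ∀ i ∈ s, ∀ j ∈ s, i ≠ j → Disjoint (u i) (u j))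
    {R : Type*} [CommSemiring R] (f : α → R) :
    ∏ i ∈ s, ∑ Δ ∈ t i, ∏ a ∈ Δ, f a = ∑ Δ ∈ (s.pi t).image (slotUnion s), ∏ a ∈ Δ, f a ∧
      Set.InjOn (slotUnion s) (s.pi t : Set ((i : ι) → i ∈ s → Finset α)) := by
  have hinj : Set.InjOn (slotUnion s) (s.pi t : Set ((i : ι) → i ∈ s → Finset α)) := by
    intro p hp p' hp' heq
    rw [mem_coe, mem_pi] at hp hp'
    funext i hi
    -- the `i`-th choice is the trace of the union on the universe `u i`
    have key : ∀ q : (i : ι) → i ∈ s → Finset α, (∀ i (h : i ∈ s), q i h ∈ t i) →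
        q i hi = (slotUnion s q).filter (· ∈ u i) := by
      intro q hq
      ext a
      simp only [mem_filter, mem_slotUnion]
      constructor
      · intro ha; exact ⟨⟨i, hi, ha⟩, htu i hi _ (hq i hi) ha⟩
      · rintro ⟨⟨j, hj, ha⟩, hau⟩
        by_cases hij : i = j
        · subst hij; exact ha
        · exact absurd hau (Finset.disjoint_left.1 (hu j hj i hi (Ne.symm hij)) (htu j hj _ (hq j hj) ha))
    rw [key p hp, key p' hp', heq]
  refine ⟨?_, hinj⟩
  rw [Finset.prod_sum, Finset.sum_image hinj]
  refine Finset.sum_congr rfl fun p hp => ?_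
  rw [mem_pi] at hp
  rw [slotUnion, Finset.prod_biUnion]
  · intro i _ j _ hij
    rw [Function.onFun]
    have hij' : i.1 ≠ j.1 := fun h => hij (Subtype.ext h)
    exact disjoint_of_subset_left (htu _ i.2 _ (hp _ i.2))
      (disjoint_of_subset_right (htu _ j.2 _ (hp _ j.2)) (hu _ i.2 _ j.2 hij'))

end Slots

namespace ContourSetup

variable {S : ContourSetup d}

/-! ### Maximal `P`-members of a family -/

section MaxP

variable (S) in
/-- The **maximal `P`-members** of a family: the members satisfying `P` that are not inside another
member satisfying `P` (for `P ≡ True`: the external contours, FV Def. 7.22; for `P =` "unstable":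
the external unstable contours of the proof of (7.68)). [cite: FriedliVelenik2017, Def. 7.22 and §7.4.3] -/
def maxP (P : S.Γ → Prop) [DecidablePred P] (Δ : Finset S.Γ) : Finset S.Γ :=
  Δ.filter fun γ => P γ ∧ ∀ γ' ∈ Δ, P γ' → ¬ S.Below γ γ'

variable {P : S.Γ → Prop} [DecidablePred P]

/-- Membership in `maxP`. [folklore] -/
theorem mem_maxP {Δ : Finset S.Γ} {γ : S.Γ} :
    γ ∈ S.maxP P Δ ↔ γ ∈ Δ ∧ P γ ∧ ∀ γ' ∈ Δ, P γ' → ¬ S.Below γ γ' := by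
  rw [maxP, mem_filter]

/-- `maxP P Δ ⊆ Δ`. [folklore] -/
theorem maxP_subset (Δ : Finset S.Γ) : S.maxP P Δ ⊆ Δ := filter_subset _ _

/-- **Every `P`-member lies below (or is) a maximal `P`-member**: take a `P`-member above it with the
largest hull. [cite: FriedliVelenik2017, §7.3 (external contours exist)] -/
theorem exists_maxP_above (hd : 2 ≤ d) {Δ : Finset S.Γ} {δ : S.Γ} (hδ : δ ∈ Δ) (hP : P δ) :
    ∃ γ ∈ S.maxP P Δ, γ = δ ∨ S.Below δ γ := by
  set T := Δ.filter fun γ => P γ ∧ (γ = δ ∨ S.Below δ γ) with hT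
  have hTne : T.Nonempty := ⟨δ, mem_filter.2 ⟨hδ, hP, Or.inl rfl⟩⟩
  obtain ⟨γ, hγT, hmax⟩ := exists_max_image T (fun γ => #(S.hull γ)) hTne
  obtain ⟨hγΔ, hPγ, hγδ⟩ := mem_filter.1 hγT
  refine ⟨γ, mem_maxP.2 ⟨hγΔ, hPγ, fun γ' hγ' hP' hbelow => ?_⟩, hγδ⟩
  have hγ'T : γ' ∈ T := by
    refine mem_filter.2 ⟨hγ', hP', Or.inr ?_⟩
    rcases hγδ with rfl | h
    · exact hbelow
    · exact h.trans hbelow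
  exact absurd (hmax γ' hγ'T) (not_le.2 (card_hull_lt_of_below hd hbelow))

/-- Maximal `P`-members of a compatible family have pairwise disjoint hulls. [cite: FriedliVelenik2017, §7.3] -/
theorem pairwise_disjoint_hull_maxP (hd : 2 ≤ d) {Δ : Finset S.Γ} (hΔ : (Δ : Set S.Γ).Pairwise S.Compat) :
    (S.maxP P Δ : Set S.Γ).Pairwise fun γ γ' => Disjoint (S.hull γ) (S.hull γ') := by
  intro γ hγ γ' hγ' hne
  obtain ⟨hγΔ, hPγ, hmaxγ⟩ := mem_maxP.1 (mem_coe.1 hγ)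
  obtain ⟨hγ'Δ, hPγ', hmaxγ'⟩ := mem_maxP.1 (mem_coe.1 hγ')
  rcases trichotomy hd (hΔ (mem_coe.2 hγΔ) (mem_coe.2 hγ'Δ) hne) with h | h | h
  · exact absurd h (hmaxγ' γ hγΔ hPγ)
  · exact absurd h (hmaxγ γ' hγ'Δ hPγ')
  · exact h

end MaxP

/-! ### The decomposition of compatible families along maximal `P`-members -/

section Decomposition

variable (S) in
/-- The volume outside the hulls of a family: `V ∖ ⋃_{γ ∈ Γ} (γ̄ ∪ int γ)` (`Λ^ext` of FV (7.28) for
the external contours). [cite: FriedliVelenik2017, §7.3, eq. (7.28) (Λ^ext)] -/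
def Wvol (V : Finset (Site d)) (Γ : Finset S.Γ) : Finset (Site d) := V \ Γ.biUnion S.hull

variable (S) in
/-- External families all of whose members satisfy `P`. [cite: FriedliVelenik2017, §7.4.3 (external unstable contours)] -/
def ExtFamP (P : S.Γ → Prop) [DecidablePred P] (σ : Phase) (V : Finset (Site d)) : Finset (Finset S.Γ) :=
  (S.ExtFam σ V).filter fun Γ => ∀ γ ∈ Γ, P γ

variable (S) in
/-- Compatible families none of whose members satisfies `P`. [cite: FriedliVelenik2017, §7.4.3 (stable contours in Λ^ext)] -/
def CompFamN (P : S.Γ → Prop) [DecidablePred P] (σ : Phase) (V : Finset (Site d)) : Finset (Finset S.Γ) :=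
  (S.CompFam σ V).filter fun Δ => ∀ δ ∈ Δ, ¬ P δ

variable {P : S.Γ → Prop} [DecidablePred P] {σ : Phase} {V : Finset (Site d)}

/-- Membership in `ExtFamP`. [folklore] -/
theorem mem_extFamP {Γ : Finset S.Γ} : Γ ∈ S.ExtFamP P σ V ↔ Γ ∈ S.ExtFam σ V ∧ ∀ γ ∈ Γ, P γ := by
  rw [ExtFamP, mem_filter]

/-- Membership in `CompFamN`. [folklore] -/
theorem mem_compFamN {Δ : Finset S.Γ} : Δ ∈ S.CompFamN P σ V ↔ Δ ∈ S.CompFam σ V ∧ ∀ δ ∈ Δ, ¬ P δ := by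
  rw [CompFamN, mem_filter]

/-- Membership in `Wvol`. [folklore] -/
theorem mem_Wvol {Γ : Finset S.Γ} {x : Site d} : x ∈ S.Wvol V Γ ↔ x ∈ V ∧ ∀ γ ∈ Γ, x ∉ S.hull γ := by
  rw [Wvol, mem_sdiff, mem_biUnion, not_exists]
  simp only [not_and]

/-- Contours with disjoint `★`-neighbourhood and support are compatible. [folklore] -/
theorem compat_of_disjoint_nbhd {δ δ' : S.Γ} (h : Disjoint ((S.supp δ).biUnion starBall) (S.supp δ')) : S.Compat δ δ' := by
  intro x hx y hy
  by_contra hxy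
  exact Finset.disjoint_left.1 h (mem_biUnion.2 ⟨x, hx, mem_starBall.2 (not_lt.1 hxy)⟩) hy

/-- The maximal `P`-members of a compatible family of `V` form a `P`-external family of `V`.
[cite: FriedliVelenik2017, §7.3 (external contours) and §7.4.3] -/
theorem maxP_mem_extFamP (hd : 2 ≤ d) {Δ : Finset S.Γ} (hΔ : Δ ∈ S.CompFam σ V) : S.maxP P Δ ∈ S.ExtFamP P σ V :=
  mem_extFamP.2 ⟨mem_extFam.2 ⟨subset_mem_compFam hΔ (maxP_subset Δ), pairwise_disjoint_hull_maxP hd (mem_compFam.1 hΔ).2⟩,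
    fun _ hγ => (mem_maxP.1 hγ).2.1⟩

/-- The slots of the decomposition for a fixed external family `Γ`: one for `V ∖ ⋃ hull`, and one
for each interior component of each member. [folklore] -/
def slots (Γ : Finset S.Γ) : Finset (Option (S.Γ × Finset (Site d))) :=
  insertNone (Γ.biUnion fun γ => (S.ints γ).image fun A => (γ, A))

variable (P σ V) in
/-- The allowed families of a slot. [folklore] -/
def slotFam (Γ : Finset S.Γ) : Option (S.Γ × Finset (Site d)) → Finset (Finset S.Γ)
  | none => S.CompFamN P σ (S.Wvol V Γ)
  | some x => S.CompFam σ x.2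

variable (P σ V) in
/-- The universe of contours of a slot. [folklore] -/
def slotUniv (Γ : Finset S.Γ) : Option (S.Γ × Finset (Site d)) → Finset S.Γ
  | none => (S.contoursIn σ (S.Wvol V Γ)).filter fun δ => ¬ P δ
  | some x => S.contoursIn σ x.2

/-- Membership of `some (γ, A)` in the slots. [folklore] -/
theorem some_mem_slots {Γ : Finset S.Γ} {γ : S.Γ} {A : Finset (Site d)} :
    some (γ, A) ∈ slots Γ ↔ γ ∈ Γ ∧ A ∈ S.ints γ := by
  rw [slots, some_mem_insertNone, mem_biUnion]
  constructor
  · rintro ⟨γ', hγ', h⟩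
    obtain ⟨A', hA', heq⟩ := mem_image.1 h
    obtain ⟨rfl, rfl⟩ := Prod.mk.inj heq
    exact ⟨hγ', hA'⟩
  · rintro ⟨hγ, hA⟩
    exact ⟨γ, hγ, mem_image.2 ⟨A, hA, rfl⟩⟩

/-- Allowed families live in the universe of their slot. [folklore] -/
theorem slotFam_subset_slotUniv {Γ : Finset S.Γ} (i : Option (S.Γ × Finset (Site d))) {Δ : Finset S.Γ}
    (hΔ : Δ ∈ slotFam P σ V Γ i) : Δ ⊆ slotUniv P σ V Γ i := by
  cases i with
  | none =>
    obtain ⟨h1, h2⟩ := mem_compFamN.1 hΔ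
    exact fun δ hδ => mem_filter.2 ⟨mem_contoursIn.2 ((mem_compFam.1 h1).1 δ hδ), h2 δ hδ⟩
  | some x => exact fun δ hδ => mem_contoursIn.2 ((mem_compFam.1 hΔ).1 δ hδ)

/-- **Facts about a contour in an interior slot** `(γ, A)`, `γ ∈ Γ`, `Γ` external: its hull lies in
`A`, it lies below `γ`, it is in `V`, it is not in `Γ`, and it is compatible with every member of
`Γ`. [cite: FriedliVelenik2017, §7.3] -/
theorem slot_some_facts (hd : 2 ≤ d) (hV : StarConn (V : Set (Site d))ᶜ) {Γ : Finset S.Γ} (hΓ : Γ ∈ S.ExtFam σ V)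
    {γ : S.Γ} {A : Finset (Site d)} (hγ : γ ∈ Γ) (hA : A ∈ S.ints γ) {δ : S.Γ} (hδ : δ ∈ S.contoursIn σ A) :
    S.hull δ ⊆ A ∧ S.Below δ γ ∧ S.InVol δ V ∧ δ ∉ Γ ∧ ∀ γ' ∈ Γ, S.Compat δ γ' := by
  obtain ⟨hΓc, hΓd⟩ := mem_extFam.1 hΓ
  obtain ⟨hΓ1, hΓ2⟩ := mem_compFam.1 hΓc
  obtain ⟨-, hδA⟩ := mem_contoursIn.1 hδ
  have hγV : S.InVol γ V := (hΓ1 γ hγ).2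
  have hAV : A ⊆ V := subset_of_mem_ints_of_inVol hd hV hγV hA
  have hhull : S.hull δ ⊆ A := hull_subset_of_supp_subset hd hA (supp_subset_of_inVol hδA)
  have hbelow : S.Below δ γ := ⟨A, hA, hhull⟩
  -- compatibility with the members of `Γ`: their supports miss `A ⊇ B(supp δ, 1)`
  have hcomp : ∀ γ' ∈ Γ, S.Compat δ γ' := by
    intro γ' hγ'
    refine compat_of_disjoint_nbhd (disjoint_of_subset_left hδA (Finset.disjoint_left.2 fun x hxA hx' => ?_))
    by_cases hγγ' : γ = γ'
    · subst hγγ'; exact Finset.disjoint_left.1 (disjoint_supp_of_mem_ints hd hA) hxA hx'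
    · exact Finset.disjoint_left.1 (hΓd (mem_coe.2 hγ) (mem_coe.2 hγ') hγγ')
        ((subset_intr_of_mem_ints hA).trans (intr_subset_hull γ) hxA) (supp_subset_hull hd γ' hx')
  have hnot : δ ∉ Γ := by
    intro hδΓ
    by_cases hγδ : γ = δ
    · subst hγδ; exact not_below_self hd _ hbelow
    · exact not_disjoint_hull_of_below hd hbelow (hΓd (mem_coe.2 hγ) (mem_coe.2 hδΓ) hγδ)
  exact ⟨hhull, hbelow, fun z hz => hAV (hδA hz), hnot, hcomp⟩

/-- **Facts about a contour in the outer slot**: it is in `V`, its `★`-neighbourhood misses the hulls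
of the members of `Γ`, it is compatible with them and it is not one of them (when they satisfy `P`).
[cite: FriedliVelenik2017, §7.3] -/
theorem slot_none_facts (hd : 2 ≤ d) {Γ : Finset S.Γ} (hΓP : ∀ γ ∈ Γ, P γ) {δ : S.Γ}
    (hδ : δ ∈ (S.contoursIn σ (S.Wvol V Γ)).filter fun δ => ¬ P δ) :
    S.InVol δ V ∧ (∀ γ ∈ Γ, Disjoint ((S.supp δ).biUnion starBall) (S.hull γ)) ∧ (∀ γ ∈ Γ, S.Compat δ γ) ∧ δ ∉ Γ := by
  obtain ⟨hδ1, hδP⟩ := mem_filter.1 hδ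
  obtain ⟨-, hδW⟩ := mem_contoursIn.1 hδ1
  have hdis : ∀ γ ∈ Γ, Disjoint ((S.supp δ).biUnion starBall) (S.hull γ) := fun γ hγ =>
    Finset.disjoint_left.2 fun z hz hzh => (mem_Wvol.1 (hδW hz)).2 γ hγ hzh
  exact ⟨fun z hz => (mem_Wvol.1 (hδW hz)).1, hdis,
    fun γ hγ => compat_of_disjoint_nbhd (disjoint_of_subset_right (supp_subset_hull hd γ) (hdis γ hγ)),
    fun h => hδP (hΓP δ h)⟩

/-- The universes of distinct slots are disjoint. [folklore] -/
theorem disjoint_slotUniv (hd : 2 ≤ d) {Γ : Finset S.Γ} (hΓ : Γ ∈ S.ExtFamP P σ V)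
    {i j : Option (S.Γ × Finset (Site d))} (hi : i ∈ slots Γ) (hj : j ∈ slots Γ) (hij : i ≠ j) :
    Disjoint (slotUniv P σ V Γ i) (slotUniv P σ V Γ j) := by
  obtain ⟨hΓe, hΓP⟩ := mem_extFamP.1 hΓ
  -- a contour of an interior slot has its (non-empty) support inside the hull of the member
  have key : ∀ γ A δ, some (γ, A) ∈ slots Γ → δ ∈ slotUniv P σ V Γ (some (γ, A)) →
      ∃ x ∈ S.supp δ, x ∈ A ∧ x ∈ S.hull γ := by
    intro γ A δ h hδ
    obtain ⟨hγ, hA⟩ := some_mem_slots.1 h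
    obtain ⟨x, hx⟩ := S.supp_nonempty δ
    have hxA : x ∈ A := supp_subset_of_inVol (mem_contoursIn.1 hδ).2 hx
    exact ⟨x, hx, hxA, (subset_intr_of_mem_ints hA).trans (intr_subset_hull γ) hxA⟩
  rw [Finset.disjoint_left]
  intro δ hδi hδj
  match i, j, hi, hj, hδi, hδj with
  | none, none, _, _, _, _ => exact hij rfl
  | none, some (γ, A), _, hj, hδi, hδj =>
    obtain ⟨x, hx, -, hxh⟩ := key γ A δ hj hδj
    obtain ⟨-, hdis, -⟩ := slot_none_facts hd hΓP hδi
    exact Finset.disjoint_left.1 (hdis γ (some_mem_slots.1 hj).1) (mem_biUnion.2 ⟨x, hx, mem_starBall_self x⟩) hxh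
  | some (γ, A), none, hi, _, hδi, hδj =>
    obtain ⟨x, hx, -, hxh⟩ := key γ A δ hi hδi
    obtain ⟨-, hdis, -⟩ := slot_none_facts hd hΓP hδj
    exact Finset.disjoint_left.1 (hdis γ (some_mem_slots.1 hi).1) (mem_biUnion.2 ⟨x, hx, mem_starBall_self x⟩) hxh
  | some (γ, A), some (γ', A'), hi, hj, hδi, hδj =>
    obtain ⟨hγ, hA⟩ := some_mem_slots.1 hi
    obtain ⟨hγ', hA'⟩ := some_mem_slots.1 hj
    obtain ⟨x, hx, hxA, hxh⟩ := key γ A δ hi hδi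
    have hxA' : x ∈ A' := supp_subset_of_inVol (mem_contoursIn.1 hδj).2 hx
    have hxh' : x ∈ S.hull γ' := (subset_intr_of_mem_ints hA').trans (intr_subset_hull γ') hxA'
    by_cases hγγ' : γ = γ'
    · subst hγγ'
      have hAA' : A ≠ A' := fun h => hij (by rw [h])
      exact Finset.disjoint_left.1 (disjoint_of_mem_ints hd hA hA' hAA') hxA hxA'
    · exact Finset.disjoint_left.1 ((mem_extFam.1 hΓe).2 (mem_coe.2 hγ) (mem_coe.2 hγ') hγγ') hxh hxh'

/-- Contours of distinct slots are compatible. [folklore] -/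
theorem compat_of_mem_slotUniv (hd : 2 ≤ d) {Γ : Finset S.Γ} (hΓ : Γ ∈ S.ExtFamP P σ V) {i j : Option (S.Γ × Finset (Site d))} (hi : i ∈ slots Γ) (hj : j ∈ slots Γ)
    (hij : i ≠ j) {δ δ' : S.Γ} (hδ : δ ∈ slotUniv P σ V Γ i) (hδ' : δ' ∈ slotUniv P σ V Γ j) : S.Compat δ δ' := by
  obtain ⟨hΓe, hΓP⟩ := mem_extFamP.1 hΓ
  -- an interior-slot contour has `B(supp, 1) ⊆ A ⊆ hull γ`
  have nb : ∀ γ A δ, some (γ, A) ∈ slots Γ → δ ∈ slotUniv P σ V Γ (some (γ, A)) →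
      (S.supp δ).biUnion starBall ⊆ A ∧ A ⊆ S.hull γ ∧ S.supp δ ⊆ A := by
    intro γ A δ h hδ
    obtain ⟨hγ, hA⟩ := some_mem_slots.1 h
    have h1 : S.InVol δ A := (mem_contoursIn.1 hδ).2
    exact ⟨h1, (subset_intr_of_mem_ints hA).trans (intr_subset_hull γ), supp_subset_of_inVol h1⟩
  match i, j, hi, hj, hδ, hδ' with
  | none, none, _, _, _, _ => exact absurd rfl hij
  | none, some (γ, A), _, hj, hδ, hδ' =>
    obtain ⟨-, hdis, -⟩ := slot_none_facts hd hΓP hδ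
    obtain ⟨-, hAh, hsA⟩ := nb γ A δ' hj hδ'
    exact compat_of_disjoint_nbhd (disjoint_of_subset_right (hsA.trans hAh) (hdis γ (some_mem_slots.1 hj).1))
  | some (γ, A), none, hi, _, hδ, hδ' =>
    obtain ⟨-, hdis, -⟩ := slot_none_facts hd hΓP hδ'
    obtain ⟨-, hAh, hsA⟩ := nb γ A δ hi hδ
    exact (compat_of_disjoint_nbhd (disjoint_of_subset_right (hsA.trans hAh) (hdis γ (some_mem_slots.1 hi).1))).symm
  | some (γ, A), some (γ', A'), hi, hj, hδ, hδ' =>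
    obtain ⟨hγ, hA⟩ := some_mem_slots.1 hi
    obtain ⟨hγ', hA'⟩ := some_mem_slots.1 hj
    obtain ⟨hnb, hAh, -⟩ := nb γ A δ hi hδ
    obtain ⟨-, hA'h, hsA'⟩ := nb γ' A' δ' hj hδ'
    refine compat_of_disjoint_nbhd (disjoint_of_subset_left hnb (disjoint_of_subset_right hsA' ?_))
    by_cases hγγ' : γ = γ'
    · subst hγγ'
      exact disjoint_of_mem_ints hd hA hA' fun h => hij (by rw [h])
    · exact disjoint_of_subset_left hAh (disjoint_of_subset_right hA'h
        ((mem_extFam.1 hΓe).2 (mem_coe.2 hγ) (mem_coe.2 hγ') hγγ'))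

/-- **The glued family `Γ ∪ ⋃ slots` is a compatible family of `V` whose maximal `P`-members are
exactly `Γ`, and `Γ` is disjoint from the glued part.** [cite: FriedliVelenik2017, §7.3 and §7.4.3] -/
theorem glue_mem_fiber (hd : 2 ≤ d) (hV : StarConn (V : Set (Site d))ᶜ) {Γ : Finset S.Γ} (hΓ : Γ ∈ S.ExtFamP P σ V)
    {p : (i : Option (S.Γ × Finset (Site d))) → i ∈ slots Γ → Finset S.Γ}
    (hp : ∀ i (h : i ∈ slots Γ), p i h ∈ slotFam P σ V Γ i) :
    Γ ∪ slotUnion (slots Γ) p ∈ S.CompFam σ V ∧ S.maxP P (Γ ∪ slotUnion (slots Γ) p) = Γ ∧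
      Disjoint Γ (slotUnion (slots Γ) p) := by
  obtain ⟨hΓe, hΓP⟩ := mem_extFamP.1 hΓ
  obtain ⟨hΓc, hΓd⟩ := mem_extFam.1 hΓe
  -- where the glued contours come from
  have hmem : ∀ δ ∈ slotUnion (slots Γ) p, ∃ i, ∃ h : i ∈ slots Γ, δ ∈ p i h ∧ δ ∈ slotUniv P σ V Γ i := by
    intro δ hδ
    obtain ⟨i, hi, hδi⟩ := mem_slotUnion.1 hδ
    exact ⟨i, hi, hδi, slotFam_subset_slotUniv i (hp i hi) hδi⟩
  -- basic facts on glued contours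
  have hfacts : ∀ δ ∈ slotUnion (slots Γ) p, S.type δ = σ ∧ S.InVol δ V ∧ δ ∉ Γ ∧ (∀ γ ∈ Γ, S.Compat δ γ) ∧
      (P δ → ∃ γ ∈ Γ, S.Below δ γ) := by
    intro δ hδ
    obtain ⟨i, hi, hδi, hδu⟩ := hmem δ hδ
    match i, hi, hδi, hδu with
    | none, hi, hδi, hδu =>
      obtain ⟨hV', -, hc, hn⟩ := slot_none_facts hd hΓP hδu
      exact ⟨(mem_contoursIn.1 (mem_filter.1 hδu).1).1, hV', hn, hc, fun hPδ => absurd hPδ (mem_filter.1 hδu).2⟩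
    | some (γ, A), hi, hδi, hδu =>
      obtain ⟨hγ, hA⟩ := some_mem_slots.1 hi
      obtain ⟨-, hb, hV', hn, hc⟩ := slot_some_facts hd hV hΓe hγ hA hδu
      exact ⟨(mem_contoursIn.1 hδu).1, hV', hn, hc, fun _ => ⟨γ, hγ, hb⟩⟩
  have hdisj : Disjoint Γ (slotUnion (slots Γ) p) :=
    Finset.disjoint_right.2 fun δ hδ => (hfacts δ hδ).2.2.1
  -- compatibility of the glued family
  have hcompat : ((Γ ∪ slotUnion (slots Γ) p : Finset S.Γ) : Set S.Γ).Pairwise S.Compat := by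
    intro δ hδ δ' hδ' hne
    rw [mem_coe, mem_union] at hδ hδ'
    rcases hδ with hδ | hδ <;> rcases hδ' with hδ' | hδ'
    · exact (mem_compFam.1 hΓc).2 (mem_coe.2 hδ) (mem_coe.2 hδ') hne
    · exact ((hfacts δ' hδ').2.2.2.1 δ hδ).symm
    · exact (hfacts δ hδ).2.2.2.1 δ' hδ'
    · obtain ⟨i, hi, hδi, hδu⟩ := hmem δ hδ
      obtain ⟨j, hj, hδj, hδu'⟩ := hmem δ' hδ'
      by_cases hij : i = j
      · subst hij
        have hfam := hp i hi
        have hpc : ((p i hi : Finset S.Γ) : Set S.Γ).Pairwise S.Compat := by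
          cases i with
          | none => exact (mem_compFam.1 (mem_compFamN.1 hfam).1).2
          | some x => exact (mem_compFam.1 hfam).2
        exact hpc (mem_coe.2 hδi) (mem_coe.2 hδj) hne
      · exact compat_of_mem_slotUniv hd hΓ hi hj hij hδu hδu'
  have hCF : Γ ∪ slotUnion (slots Γ) p ∈ S.CompFam σ V := by
    refine mem_compFam.2 ⟨fun δ hδ => ?_, hcompat⟩
    rcases mem_union.1 hδ with hδ | hδ
    · exact (mem_compFam.1 hΓc).1 δ hδ
    · exact ⟨(hfacts δ hδ).1, (hfacts δ hδ).2.1⟩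
  refine ⟨hCF, ?_, hdisj⟩
  -- the maximal `P`-members of the glued family are exactly `Γ`
  ext γ
  rw [mem_maxP, mem_union]
  constructor
  · rintro ⟨hγ | hγ, hPγ, hmax⟩
    · exact hγ
    · obtain ⟨γ', hγ', hb⟩ := (hfacts γ hγ).2.2.2.2 hPγ
      exact absurd hb (hmax γ' (mem_union.2 (Or.inl hγ')) (hΓP γ' hγ'))
  · intro hγ
    refine ⟨Or.inl hγ, hΓP γ hγ, fun γ₂ hγ₂ hP₂ hb => ?_⟩
    rcases mem_union.1 hγ₂ with hγ₂ | hγ₂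
    · by_cases h : γ = γ₂
      · subst h; exact not_below_self hd _ hb
      · exact not_disjoint_hull_of_below hd hb (hΓd (mem_coe.2 hγ₂) (mem_coe.2 hγ) (Ne.symm h))
    · obtain ⟨i, hi, hδi, hδu⟩ := hmem γ₂ hγ₂
      match i, hi, hδi, hδu with
      | none, hi, hδi, hδu => exact (mem_filter.1 hδu).2 hP₂
      | some (γ₀, A), hi, hδi, hδu =>
        obtain ⟨hγ₀, hA⟩ := some_mem_slots.1 hi
        obtain ⟨hhull, -, -, -, -⟩ := slot_some_facts hd hV hΓe hγ₀ hA hδu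
        -- `hull γ ⊆ int γ₂ ⊆ hull γ₂ ⊆ A ⊆ hull γ₀`
        have hsub : S.hull γ ⊆ A := by
          obtain ⟨A₂, hA₂, h₂⟩ := hb
          exact h₂.trans (((subset_intr_of_mem_ints hA₂).trans (intr_subset_hull γ₂)).trans hhull)
        by_cases h0 : γ = γ₀
        · subst h0
          obtain ⟨x, hx⟩ := S.supp_nonempty γ
          exact not_mem_supp_of_mem_intr hd (subset_intr_of_mem_ints hA (hsub (supp_subset_hull hd γ hx))) hx
        · obtain ⟨x, hx⟩ := S.supp_nonempty γ
          exact Finset.disjoint_left.1 (hΓd (mem_coe.2 hγ) (mem_coe.2 hγ₀) h0) (supp_subset_hull hd γ hx)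
            ((subset_intr_of_mem_ints hA).trans (intr_subset_hull γ₀) (hsub (supp_subset_hull hd γ hx)))

/-- **Every compatible family with maximal `P`-members `Γ` is glued from allowed choices in the slots.**
[cite: FriedliVelenik2017, §7.3 and §7.4.3] -/
theorem exists_glue_of_maxP_eq (hd : 2 ≤ d) {Γ : Finset S.Γ} {Δ : Finset S.Γ}
    (hΔ : Δ ∈ S.CompFam σ V) (hmax : S.maxP P Δ = Γ) :
    ∃ p : (i : Option (S.Γ × Finset (Site d))) → i ∈ slots Γ → Finset S.Γ,
      (∀ i (h : i ∈ slots Γ), p i h ∈ slotFam P σ V Γ i) ∧ Γ ∪ slotUnion (slots Γ) p = Δ := by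
  obtain ⟨hΔ1, hΔ2⟩ := mem_compFam.1 hΔ
  have hΓΔ : Γ ⊆ Δ := hmax ▸ maxP_subset Δ
  have hΓP : ∀ γ ∈ Γ, P γ := fun γ hγ => (mem_maxP.1 (hmax.symm ▸ hγ : γ ∈ S.maxP P Δ)).2.1
  -- the pieces
  set p : (i : Option (S.Γ × Finset (Site d))) → i ∈ slots Γ → Finset S.Γ := fun i _ =>
    match i with
    | none => Δ.filter fun δ => δ ∉ Γ ∧ ∀ γ ∈ Γ, ¬ S.Below δ γ
    | some x => Δ.filter fun δ => δ ∉ Γ ∧ S.hull δ ⊆ x.2 with hpdef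
  -- compatibility of a non-member of `Γ` with the members of `Γ`
  have hcomp : ∀ δ ∈ Δ, δ ∉ Γ → ∀ γ ∈ Γ, S.Compat δ γ := fun δ hδ hδΓ γ hγ =>
    hΔ2 (mem_coe.2 hδ) (mem_coe.2 (hΓΔ hγ)) fun h => hδΓ (h ▸ hγ)
  refine ⟨p, fun i hi => ?_, ?_⟩
  · match i, hi with
    | none, _ =>
      refine mem_compFamN.2 ⟨mem_compFam.2 ⟨fun δ hδ => ?_, hΔ2.mono (coe_subset.2 (filter_subset _ _))⟩, fun δ hδ hPδ => ?_⟩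
      · obtain ⟨hδΔ, hδΓ, hnb⟩ := mem_filter.1 hδ
        refine ⟨(hΔ1 δ hδΔ).1, fun z hz => mem_Wvol.2 ⟨(hΔ1 δ hδΔ).2 hz, fun γ hγ hzh => ?_⟩⟩
        exact Finset.disjoint_left.1 (disjoint_nbhd_hull_of_not_below hd (hcomp δ hδΔ hδΓ γ hγ) (hnb γ hγ)) hz hzh
      · obtain ⟨hδΔ, hδΓ, hnb⟩ := mem_filter.1 hδ
        obtain ⟨γ, hγ, h⟩ := exists_maxP_above hd hδΔ hPδ
        rw [hmax] at hγ
        rcases h with rfl | h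
        · exact hδΓ hγ
        · exact hnb γ hγ h
    | some (γ, A), hi =>
      obtain ⟨hγ, hA⟩ := some_mem_slots.1 hi
      refine mem_compFam.2 ⟨fun δ hδ => ?_, hΔ2.mono (coe_subset.2 (filter_subset _ _))⟩
      obtain ⟨hδΔ, hδΓ, hh⟩ := mem_filter.1 hδ
      exact ⟨(hΔ1 δ hδΔ).1, inVol_of_hull_subset hd (hcomp δ hδΔ hδΓ γ hγ) hA hh⟩
  · ext δ
    rw [mem_union, mem_slotUnion]
    constructor
    · rintro (hδ | ⟨i, hi, hδ⟩)
      · exact hΓΔ hδ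
      · match i, hi, hδ with
        | none, _, hδ => exact (mem_filter.1 hδ).1
        | some x, _, hδ => exact (mem_filter.1 hδ).1
    · intro hδ
      by_cases hδΓ : δ ∈ Γ
      · exact Or.inl hδΓ
      · right
        by_cases hb : ∃ γ ∈ Γ, S.Below δ γ
        · obtain ⟨γ, hγ, A, hA, hh⟩ := hb
          exact ⟨some (γ, A), some_mem_slots.2 ⟨hγ, hA⟩, mem_filter.2 ⟨hδ, hδΓ, hh⟩⟩
        · push Not at hb
          exact ⟨none, by rw [slots]; exact none_mem_insertNone, mem_filter.2 ⟨hδ, hδΓ, hb⟩⟩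

/-- **The sum over the fibre of `maxP` at `Γ` factorises over the slots.**
[cite: FriedliVelenik2017, §7.3, eqs. (7.32)–(7.34) and §7.4.3, eq. (7.86)] -/
theorem sum_fiber_maxP_eq (hd : 2 ≤ d) (hV : StarConn (V : Set (Site d))ᶜ) {Γ : Finset S.Γ} (hΓ : Γ ∈ S.ExtFamP P σ V)
    (f : S.Γ → ℝ) :
    ∑ Δ ∈ (S.CompFam σ V).filter (fun Δ => S.maxP P Δ = Γ), ∏ δ ∈ Δ, f δ =
      (∏ γ ∈ Γ, f γ) * ((∑ Δ ∈ S.CompFamN P σ (S.Wvol V Γ), ∏ δ ∈ Δ, f δ) *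
        ∏ γ ∈ Γ, ∏ A ∈ S.ints γ, ∑ Δ ∈ S.CompFam σ A, ∏ δ ∈ Δ, f δ) := by
  classical
  -- the product over the slots
  have hslots : (∑ Δ ∈ S.CompFamN P σ (S.Wvol V Γ), ∏ δ ∈ Δ, f δ) *
      ∏ γ ∈ Γ, ∏ A ∈ S.ints γ, ∑ Δ ∈ S.CompFam σ A, ∏ δ ∈ Δ, f δ =
        ∏ i ∈ slots Γ, ∑ Δ ∈ slotFam P σ V Γ i, ∏ δ ∈ Δ, f δ := by
    rw [slots, prod_insertNone]
    congr 1
    rw [prod_biUnion]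
    · refine prod_congr rfl fun γ _ => ?_
      rw [prod_image fun A _ A' _ h => (Prod.mk.inj h).2]
      rfl
    · intro γ _ γ' _ hne
      rw [Function.onFun, Finset.disjoint_left]
      intro x hx hx'
      obtain ⟨A, -, rfl⟩ := mem_image.1 hx
      obtain ⟨A', -, h⟩ := mem_image.1 hx'
      exact hne (Prod.mk.inj h).1.symm
  obtain ⟨hgen, hinj⟩ := prod_sum_prod_eq_sum_image_slotUnion (slots Γ) (slotFam P σ V Γ) (slotUniv P σ V Γ)
    (fun i _ Δ hΔ => slotFam_subset_slotUniv i hΔ) (fun i hi j hj hij => disjoint_slotUniv hd hΓ hi hj hij) f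
  rw [hslots, hgen, mul_sum]
  -- the fibre is the image of the glued families
  have hfib : (S.CompFam σ V).filter (fun Δ => S.maxP P Δ = Γ) =
      (((slots Γ).pi (slotFam P σ V Γ)).image (slotUnion (slots Γ))).image fun Δ' => Γ ∪ Δ' := by
    ext Δ
    rw [mem_filter, image_image, mem_image]
    constructor
    · rintro ⟨hΔ, hmax⟩
      obtain ⟨p, hp, rfl⟩ := exists_glue_of_maxP_eq hd hΔ hmax
      exact ⟨p, mem_pi.2 hp, rfl⟩
    · rintro ⟨p, hp, rfl⟩
      obtain ⟨h1, h2, -⟩ := glue_mem_fiber hd hV hΓ (mem_pi.1 hp)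
      exact ⟨h1, h2⟩
  rw [hfib, sum_image]
  · refine sum_congr rfl fun Δ' hΔ' => ?_
    obtain ⟨p, hp, rfl⟩ := mem_image.1 hΔ'
    rw [prod_union (glue_mem_fiber hd hV hΓ (mem_pi.1 hp)).2.2]
  · intro Δ₁ h₁ Δ₂ h₂ heq
    obtain ⟨p₁, hp₁, rfl⟩ := mem_image.1 (mem_coe.1 h₁)
    obtain ⟨p₂, hp₂, rfl⟩ := mem_image.1 (mem_coe.1 h₂)
    have hd₁ := (glue_mem_fiber hd hV hΓ (mem_pi.1 hp₁)).2.2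
    have hd₂ := (glue_mem_fiber hd hV hΓ (mem_pi.1 hp₂)).2.2
    rw [← union_sdiff_cancel_left hd₁, ← union_sdiff_cancel_left hd₂]
    exact congrArg (· \ Γ) heq

/-- **The resummation identity** (Friedli–Velenik §7.3/§7.4.3, abstract form): the sum over all
compatible families of `V` of `∏ f` splits over the `P`-external families `Γ` of `V` into
`∏_Γ f` times the sum over the non-`P` compatible families of `V ∖ ⋃ hull Γ` times, for each
interior component of each member of `Γ`, the sum over all compatible families of that component.
[cite: FriedliVelenik2017, §7.3, eqs. (7.32)–(7.34); §7.4.3, eq. (7.86)] -/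
theorem sum_compFam_eq_sum_extFamP (hd : 2 ≤ d) (hV : StarConn (V : Set (Site d))ᶜ) (P : S.Γ → Prop) [DecidablePred P]
    (σ : Phase) (f : S.Γ → ℝ) :
    ∑ Δ ∈ S.CompFam σ V, ∏ δ ∈ Δ, f δ =
      ∑ Γ ∈ S.ExtFamP P σ V, (∏ γ ∈ Γ, f γ) * ((∑ Δ ∈ S.CompFamN P σ (S.Wvol V Γ), ∏ δ ∈ Δ, f δ) *
        ∏ γ ∈ Γ, ∏ A ∈ S.ints γ, ∑ Δ ∈ S.CompFam σ A, ∏ δ ∈ Δ, f δ) := by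
  classical
  rw [← sum_fiberwise_of_maps_to (g := S.maxP P) (fun Δ hΔ => maxP_mem_extFamP hd hΔ)]
  exact sum_congr rfl fun Γ hΓ => sum_fiber_maxP_eq hd hV hΓ f

/-- **From the polymer families to the external families** (`P ≡ True`): the sum over the compatible
families of `V` of `∏ f` equals the sum over the external families `Γ` of
`∏_{γ ∈ Γ} f γ ∏_{A ∈ ints γ} (Σ over the compatible families of A of ∏ f)` — the identity between
eqs. (7.34) and (7.32) of Friedli–Velenik. [cite: FriedliVelenik2017, §7.3, eqs. (7.32)–(7.34)] -/
theorem sum_compFam_eq_sum_extFam (hd : 2 ≤ d) (hV : StarConn (V : Set (Site d))ᶜ) (σ : Phase) (f : S.Γ → ℝ) :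
    ∑ Δ ∈ S.CompFam σ V, ∏ δ ∈ Δ, f δ =
      ∑ Γ ∈ S.ExtFam σ V, ∏ γ ∈ Γ, (f γ * ∏ A ∈ S.ints γ, ∑ Δ ∈ S.CompFam σ A, ∏ δ ∈ Δ, f δ) := by
  classical
  rw [sum_compFam_eq_sum_extFamP hd hV (fun _ => True) σ f]
  have h1 : S.ExtFamP (fun _ => True) σ V = S.ExtFam σ V := by
    ext Γ; rw [mem_extFamP]; simp
  have h2 : ∀ Γ, S.CompFamN (fun _ : S.Γ => True) σ (S.Wvol V Γ) = {∅} := by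
    intro Γ
    ext Δ
    rw [mem_compFamN, mem_singleton]
    constructor
    · rintro ⟨-, h⟩
      exact eq_empty_of_forall_notMem fun δ hδ => h δ hδ trivial
    · rintro rfl
      exact ⟨empty_mem_compFam σ _, fun δ hδ => absurd hδ (notMem_empty δ)⟩
  rw [h1]
  refine sum_congr rfl fun Γ _ => ?_
  rw [h2, sum_singleton, prod_empty, one_mul, prod_mul_distrib]

end Decomposition

/-! ### External families through a given contour (Lemma 7.26) -/

section Through

variable {σ : Phase} {V : Finset (Site d)}

/-- External families through `γ₀`, with `γ₀` removed. [cite: FriedliVelenik2017, §7.3.2, Lemma 7.26] -/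
theorem sum_extFam_filter_mem_eq {γ₀ : S.Γ} (f : S.Γ → ℝ) :
    ∑ Γ ∈ (S.ExtFam σ V).filter (fun Γ => γ₀ ∈ Γ), ∏ γ ∈ Γ, f γ =
      f γ₀ * ∑ Γ ∈ (S.ExtFam σ V).filter (fun Γ => γ₀ ∉ Γ ∧ insert γ₀ Γ ∈ S.ExtFam σ V), ∏ γ ∈ Γ, f γ := by
  have hset : (S.ExtFam σ V).filter (fun Γ => γ₀ ∈ Γ) =
      ((S.ExtFam σ V).filter (fun Γ => γ₀ ∉ Γ ∧ insert γ₀ Γ ∈ S.ExtFam σ V)).image (insert γ₀) := by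
    ext Γ
    rw [mem_filter, mem_image]
    constructor
    · rintro ⟨hΓ, h₀⟩
      refine ⟨Γ.erase γ₀, mem_filter.2 ⟨subset_mem_extFam hΓ (erase_subset _ _), notMem_erase _ _, ?_⟩, insert_erase h₀⟩
      rwa [insert_erase h₀]
    · rintro ⟨Γ', hΓ', rfl⟩
      exact ⟨(mem_filter.1 hΓ').2.2, mem_insert_self _ _⟩
  rw [hset, sum_image, mul_sum]
  · exact sum_congr rfl fun Γ hΓ => prod_insert (mem_filter.1 hΓ).2.1
  · intro Γ₁ h₁ Γ₂ h₂ heq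
    have h₁' := (mem_filter.1 (mem_coe.1 h₁)).2.1
    have h₂' := (mem_filter.1 (mem_coe.1 h₂)).2.1
    rw [← erase_insert h₁', ← erase_insert h₂', heq]

/-- **The injection behind Lemma 7.26**: gluing an external family of `V` avoiding `γ₀` with
external families of the interior components of `γ₀` gives an external family of `V`, injectively;
hence, for non-negative `f`, the product of the corresponding sums is at most the sum over all
external families of `V`. [cite: FriedliVelenik2017, §7.3.2, Lemma 7.26 (proof: "the same steps that started with (7.29)")] -/
theorem sum_extFam_avoid_mul_prod_le (hd : 2 ≤ d) (hV : StarConn (V : Set (Site d))ᶜ) {γ₀ : S.Γ}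
    (h₀ : γ₀ ∈ S.contoursIn σ V) (f : S.Γ → ℝ) (hf : ∀ γ, 0 ≤ f γ) :
    (∑ Γ ∈ (S.ExtFam σ V).filter (fun Γ => γ₀ ∉ Γ ∧ insert γ₀ Γ ∈ S.ExtFam σ V), ∏ γ ∈ Γ, f γ) *
        ∏ A ∈ S.ints γ₀, ∑ Γ ∈ S.ExtFam σ A, ∏ γ ∈ Γ, f γ ≤
      ∑ Γ ∈ S.ExtFam σ V, ∏ γ ∈ Γ, f γ := by
  classical
  obtain ⟨-, h₀V⟩ := mem_contoursIn.1 h₀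
  -- slots: the outside of `γ₀` and its interior components
  set s : Finset (Option (Finset (Site d))) := insertNone (S.ints γ₀) with hs
  set t : Option (Finset (Site d)) → Finset (Finset S.Γ) := fun i =>
    match i with
    | none => (S.ExtFam σ V).filter fun Γ => γ₀ ∉ Γ ∧ insert γ₀ Γ ∈ S.ExtFam σ V
    | some A => S.ExtFam σ A with ht
  set u : Option (Finset (Site d)) → Finset S.Γ := fun i =>
    match i with
    | none => (S.contoursIn σ V).filter fun γ => Disjoint (S.hull γ) (S.hull γ₀)
    | some A => S.contoursIn σ A with hu
  -- members of the outer slot avoid the hull of `γ₀`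
  have houter : ∀ Γ ∈ t none, ∀ γ ∈ Γ, γ ∈ S.contoursIn σ V ∧ Disjoint (S.hull γ) (S.hull γ₀) := by
    intro Γ hΓ γ hγ
    obtain ⟨hΓe, h0, hins⟩ := mem_filter.1 hΓ
    refine ⟨mem_contoursIn.2 ((mem_compFam.1 (mem_extFam.1 hΓe).1).1 γ hγ), ?_⟩
    exact (mem_extFam.1 hins).2 (mem_coe.2 (mem_insert_of_mem hγ)) (mem_coe.2 (mem_insert_self _ _)) fun h => h0 (h ▸ hγ)
  -- members of an interior slot
  have hinner : ∀ A ∈ S.ints γ₀, ∀ δ ∈ S.contoursIn σ A,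
      S.hull δ ⊆ A ∧ (S.supp δ).biUnion starBall ⊆ A ∧ A ⊆ S.hull γ₀ ∧ S.InVol δ V := by
    intro A hA δ hδ
    have h1 : S.InVol δ A := (mem_contoursIn.1 hδ).2
    exact ⟨hull_subset_of_supp_subset hd hA (supp_subset_of_inVol h1), h1,
      (subset_intr_of_mem_ints hA).trans (intr_subset_hull γ₀),
      fun z hz => subset_of_mem_ints_of_inVol hd hV h₀V hA (h1 hz)⟩
  have htu : ∀ i ∈ s, ∀ Γ ∈ t i, Γ ⊆ u i := by
    intro i hi Γ hΓ
    match i, hi, hΓ with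
    | none, _, hΓ => exact fun γ hγ => mem_filter.2 (houter Γ hΓ γ hγ)
    | some A, _, hΓ => exact fun γ hγ => mem_contoursIn.2 ((mem_compFam.1 (mem_extFam.1 hΓ).1).1 γ hγ)
  have hdisj : ∀ i ∈ s, ∀ j ∈ s, i ≠ j → Disjoint (u i) (u j) := by
    intro i hi j hj hij
    rw [Finset.disjoint_left]
    intro δ hδi hδj
    obtain ⟨x, hx⟩ := S.supp_nonempty δ
    match i, j, hi, hj, hδi, hδj with
    | none, none, _, _, _, _ => exact hij rfl
    | none, some A, _, hj, hδi, hδj =>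
      obtain ⟨hh, -, hAh, -⟩ := hinner A (some_mem_insertNone.1 hj) δ hδj
      exact Finset.disjoint_left.1 (mem_filter.1 hδi).2 (supp_subset_hull hd δ hx) (hAh (hh (supp_subset_hull hd δ hx)))
    | some A, none, hi, _, hδi, hδj =>
      obtain ⟨hh, -, hAh, -⟩ := hinner A (some_mem_insertNone.1 hi) δ hδi
      exact Finset.disjoint_left.1 (mem_filter.1 hδj).2 (supp_subset_hull hd δ hx) (hAh (hh (supp_subset_hull hd δ hx)))
    | some A, some A', hi, hj, hδi, hδj =>
      have hAA' : A ≠ A' := fun h => hij (by rw [h])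
      exact Finset.disjoint_left.1 (disjoint_of_mem_ints hd (some_mem_insertNone.1 hi) (some_mem_insertNone.1 hj) hAA')
        (supp_subset_of_inVol (mem_contoursIn.1 hδi).2 hx) (supp_subset_of_inVol (mem_contoursIn.1 hδj).2 hx)
  obtain ⟨hgen, -⟩ := prod_sum_prod_eq_sum_image_slotUnion s t u htu hdisj f
  have hlhs : (∑ Γ ∈ (S.ExtFam σ V).filter (fun Γ => γ₀ ∉ Γ ∧ insert γ₀ Γ ∈ S.ExtFam σ V), ∏ γ ∈ Γ, f γ) *
      ∏ A ∈ S.ints γ₀, ∑ Γ ∈ S.ExtFam σ A, ∏ γ ∈ Γ, f γ = ∏ i ∈ s, ∑ Δ ∈ t i, ∏ a ∈ Δ, f a := by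
    rw [hs, prod_insertNone]
  rw [hlhs, hgen]
  refine sum_le_sum_of_subset_of_nonneg (fun Δ hΔ => ?_) fun Δ _ _ => prod_nonneg fun γ _ => hf γ
  obtain ⟨p, hp, rfl⟩ := mem_image.1 hΔ
  rw [mem_pi] at hp
  have hmem : ∀ δ ∈ slotUnion s p, ∃ i, ∃ h : i ∈ s, δ ∈ p i h ∧ δ ∈ u i := fun δ hδ => by
    obtain ⟨i, hi, hδ⟩ := mem_slotUnion.1 hδ
    exact ⟨i, hi, hδ, htu i hi _ (hp i hi) hδ⟩
  refine mem_extFam.2 ⟨mem_compFam.2 ⟨fun δ hδ => ?_, fun δ hδ δ' hδ' hne => ?_⟩, fun δ hδ δ' hδ' hne => ?_⟩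
  · obtain ⟨i, hi, -, hδu⟩ := hmem δ hδ
    match i, hi, hδu with
    | none, _, hδu => exact mem_contoursIn.1 (mem_filter.1 hδu).1
    | some A, hi, hδu => exact ⟨(mem_contoursIn.1 hδu).1, (hinner A (some_mem_insertNone.1 hi) δ hδu).2.2.2⟩
  · obtain ⟨i, hi, hδi, hδu⟩ := hmem δ hδ
    obtain ⟨j, hj, hδj, hδu'⟩ := hmem δ' hδ'
    by_cases hij : i = j
    · subst hij
      have hfam := hp i hi
      match i, hi, hj, hfam, hδi, hδj with
      | none, _, _, hfam, hδi, hδj =>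
        exact (mem_compFam.1 (mem_extFam.1 (mem_filter.1 hfam).1).1).2 (mem_coe.2 hδi) (mem_coe.2 hδj) hne
      | some A, _, _, hfam, hδi, hδj => exact (mem_compFam.1 (mem_extFam.1 hfam).1).2 (mem_coe.2 hδi) (mem_coe.2 hδj) hne
    · match i, j, hi, hj, hδu, hδu' with
      | none, none, _, _, _, _ => exact absurd rfl hij
      | none, some A, _, hj, hδu, hδu' =>
        obtain ⟨-, hnb, hAh, -⟩ := hinner A (some_mem_insertNone.1 hj) δ' hδu'
        refine (compat_of_disjoint_nbhd (disjoint_of_subset_left (hnb.trans hAh) ?_)).symm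
        exact disjoint_of_subset_right (supp_subset_hull hd δ) (mem_filter.1 hδu).2.symm
      | some A, none, hi, _, hδu, hδu' =>
        obtain ⟨-, hnb, hAh, -⟩ := hinner A (some_mem_insertNone.1 hi) δ hδu
        refine compat_of_disjoint_nbhd (disjoint_of_subset_left (hnb.trans hAh) ?_)
        exact disjoint_of_subset_right (supp_subset_hull hd δ') (mem_filter.1 hδu').2.symm
      | some A, some A', hi, hj, hδu, hδu' =>
        obtain ⟨-, hnb, -, -⟩ := hinner A (some_mem_insertNone.1 hi) δ hδu
        have hAA' : A ≠ A' := fun h => hij (by rw [h])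
        exact compat_of_disjoint_nbhd (disjoint_of_subset_left hnb (disjoint_of_subset_right
          (supp_subset_of_inVol (mem_contoursIn.1 hδu').2)
          (disjoint_of_mem_ints hd (some_mem_insertNone.1 hi) (some_mem_insertNone.1 hj) hAA')))
  · obtain ⟨i, hi, hδi, hδu⟩ := hmem δ hδ
    obtain ⟨j, hj, hδj, hδu'⟩ := hmem δ' hδ'
    by_cases hij : i = j
    · subst hij
      have hfam := hp i hi
      match i, hi, hj, hfam, hδi, hδj with
      | none, _, _, hfam, hδi, hδj => exact (mem_extFam.1 (mem_filter.1 hfam).1).2 (mem_coe.2 hδi) (mem_coe.2 hδj) hne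
      | some A, _, _, hfam, hδi, hδj => exact (mem_extFam.1 hfam).2 (mem_coe.2 hδi) (mem_coe.2 hδj) hne
    · match i, j, hi, hj, hδu, hδu' with
      | none, none, _, _, _, _ => exact absurd rfl hij
      | none, some A, _, hj, hδu, hδu' =>
        obtain ⟨hh, -, hAh, -⟩ := hinner A (some_mem_insertNone.1 hj) δ' hδu'
        exact disjoint_of_subset_right (hh.trans hAh) (mem_filter.1 hδu).2
      | some A, none, hi, _, hδu, hδu' =>
        obtain ⟨hh, -, hAh, -⟩ := hinner A (some_mem_insertNone.1 hi) δ hδu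
        exact (disjoint_of_subset_right (hh.trans hAh) (mem_filter.1 hδu').2).symm
      | some A, some A', hi, hj, hδu, hδu' =>
        obtain ⟨hh, -, -, -⟩ := hinner A (some_mem_insertNone.1 hi) δ hδu
        obtain ⟨hh', -, -, -⟩ := hinner A' (some_mem_insertNone.1 hj) δ' hδu'
        have hAA' : A ≠ A' := fun h => hij (by rw [h])
        exact disjoint_of_subset_left hh (disjoint_of_subset_right hh'
          (disjoint_of_mem_ints hd (some_mem_insertNone.1 hi) (some_mem_insertNone.1 hj) hAA'))

end Through



end ContourSetup

end Literature.Probability.LatticeModels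

end
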